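import Summits.NavierStokesRegularity.TurbBounds.LegendreCoeffs
import HarnessLib

/-!
# Legendre truncations and tails of real polynomials on `[-1, 1]`
(cell `pub-turb` / `turb-bounds`; v2 staging — ingredient of the tail lemma for rules with `P > 0` (rbsdp SPEC 3.5: the
remainders `w̃₀ = Σ_{n>N} ŵ_n P_n`, `θ̃₀`, and the coupling remainder `2∫ g w̃₀ θ̃₀` with its Young bound SPEC 3.6).)

HONEST FRAMING: rigorous bounds for the stated PDE and boundary conditions; no claim about physical turbulence beyond the bound.
PROVED: `legTrunc N p = Σ_{n≤N} ĉ_n P_n`, `legTail N p = p - legTrunc N p`; their coefficients; `integral_legTail_mul`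
(`∫ (legTail N p)·q = Σ_{N<n<R} w_n ĉ_n(p) ĉ_n(q)`), `integral_legTail_sq`; `integral_legTail_mul_of_natDegree_le` (the tail is
orthogonal to every polynomial of degree `≤ N`); and the Young bound `coupling_tail_bound`:
`|2∫ g·u·v| ≤ T(ε∫u² + ε⁻¹∫v²)` for continuous `g, u, v` with `|g| ≤ T` on `[-1,1]`.
-/

set_option linter.style.longLine false

noncomputable section

namespace Summit.NavierStokesRegularity.TurbBounds.LegendreTails

open Polynomial intervalIntegral MeasureTheory Finset Set Literature.Analysis.SpecialFunctions
open Summit.NavierStokesRegularity.TurbBounds.LadderTail (w w_pos)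
open Summit.NavierStokesRegularity.TurbBounds.LegendreCoeffs

/-- The Legendre truncation `Σ_{n ≤ N} ĉ_n(p) P_n` of a polynomial. -/
def legTrunc (N : ℕ) (p : ℝ[X]) : ℝ[X] := ∑ n ∈ range (N + 1), C (legCoeff p n) * legendre n

/-- The Legendre tail `p - Σ_{n ≤ N} ĉ_n(p) P_n`. -/
def legTail (N : ℕ) (p : ℝ[X]) : ℝ[X] := p - legTrunc N p

/-- Coefficients of the truncation. -/
theorem legCoeff_legTrunc (N : ℕ) (p : ℝ[X]) (n : ℕ) :
    legCoeff (legTrunc N p) n = if n ≤ N then legCoeff p n else 0 := by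
  unfold legTrunc
  rw [legCoeff_expansion]

/-- Coefficients of the tail. -/
theorem legCoeff_legTail (N : ℕ) (p : ℝ[X]) (n : ℕ) :
    legCoeff (legTail N p) n = if n ≤ N then 0 else legCoeff p n := by
  unfold legTail
  rw [legCoeff_sub, legCoeff_legTrunc]
  split_ifs <;> ring

/-- `deg (legTrunc N p) ≤ N`. -/
theorem natDegree_legTrunc_le (N : ℕ) (p : ℝ[X]) : (legTrunc N p).natDegree ≤ N := by
  unfold legTrunc
  refine natDegree_sum_le_of_forall_le _ _ (fun n hn => ?_)
  refine (natDegree_C_mul_le _ _).trans ?_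
  rw [natDegree_legendre]
  rw [Finset.mem_range] at hn; omega

/-- `deg (legTail N p) ≤ max (deg p) N`. -/
theorem natDegree_legTail_le (N : ℕ) (p : ℝ[X]) : (legTail N p).natDegree ≤ max p.natDegree N := by
  unfold legTail
  refine (natDegree_sub_le _ _).trans ?_
  exact max_le_max le_rfl (natDegree_legTrunc_le N p)

/-- `p = legTrunc N p + legTail N p` (pointwise). -/
theorem eval_trunc_add_tail (N : ℕ) (p : ℝ[X]) (x : ℝ) : p.eval x = (legTrunc N p).eval x + (legTail N p).eval x := by
  unfold legTail; rw [eval_sub]; ring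

/-- **`∫ (legTail N p)·q = Σ_{n<R, N<n} w_n ĉ_n(p) ĉ_n(q)`** for any window `R` beyond both degrees and `N`. -/
theorem integral_legTail_mul (N : ℕ) (p q : ℝ[X]) {R : ℕ} (hp : p.natDegree < R) (hq : q.natDegree < R) (hN : N < R) :
    ∫ x in (-1 : ℝ)..1, (legTail N p).eval x * q.eval x
      = ∑ n ∈ range R, if n ≤ N then 0 else w n * legCoeff p n * legCoeff q n := by
  have hdeg : (legTail N p).natDegree < R := lt_of_le_of_lt (natDegree_legTail_le N p) (max_lt hp hN)
  rw [integral_mul_eq_sum_of_lt _ _ hdeg hq]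
  refine sum_congr rfl fun n _ => ?_
  rw [legCoeff_legTail]
  split_ifs <;> ring

/-- **`∫ (legTail N p)² = Σ_{n<R, N<n} w_n ĉ_n(p)²`.** -/
theorem integral_legTail_sq (N : ℕ) (p : ℝ[X]) {R : ℕ} (hp : p.natDegree < R) (hN : N < R) :
    ∫ x in (-1 : ℝ)..1, (legTail N p).eval x ^ 2 = ∑ n ∈ range R, if n ≤ N then 0 else w n * legCoeff p n ^ 2 := by
  have hdeg : (legTail N p).natDegree < R := lt_of_le_of_lt (natDegree_legTail_le N p) (max_lt hp hN)
  have e : ∫ x in (-1 : ℝ)..1, (legTail N p).eval x ^ 2 = ∫ x in (-1 : ℝ)..1, (legTail N p).eval x * (legTail N p).eval x :=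
    intervalIntegral.integral_congr fun x _ => by ring
  rw [e, integral_mul_eq_sum_of_lt _ _ hdeg hdeg]
  refine sum_congr rfl fun n _ => ?_
  rw [legCoeff_legTail]
  split_ifs <;> ring

/-- The tail is orthogonal to every polynomial of degree `≤ N`. -/
theorem integral_legTail_mul_of_natDegree_le (N : ℕ) (p q : ℝ[X]) (hq : q.natDegree ≤ N) :
    ∫ x in (-1 : ℝ)..1, (legTail N p).eval x * q.eval x = 0 := by
  set R := max p.natDegree N + 1 with hR
  rw [integral_legTail_mul N p q (R := R) (by omega) (by omega) (by omega)]
  refine sum_eq_zero fun n _ => ?_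
  split_ifs with h
  · rfl
  · rw [legCoeff_eq_zero_of_lt q (by omega)]; ring

/-- **Young bound for the coupling remainder** (rbsdp SPEC 3.6 / FWGP17 Lemma 5, `L∞ × L² × L²` form): for continuous `u, v` and
`|g| ≤ T` on `[-1, 1]`, `ε > 0`: `|2∫_{-1}^1 g u v| ≤ T·(ε ∫ u² + ε⁻¹ ∫ v²)`. -/
theorem coupling_tail_bound {g u v : ℝ → ℝ} (hg : Continuous g) (hu : Continuous u) (hv : Continuous v) {T ε : ℝ}
    (hT : ∀ x ∈ Icc (-1 : ℝ) 1, |g x| ≤ T) (hε : 0 < ε) :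
    |2 * ∫ x in (-1 : ℝ)..1, g x * u x * v x|
      ≤ T * (ε * (∫ x in (-1 : ℝ)..1, u x ^ 2) + ε⁻¹ * (∫ x in (-1 : ℝ)..1, v x ^ 2)) := by
  have hT0 : 0 ≤ T := le_trans (abs_nonneg _) (hT (-1) ⟨le_rfl, by norm_num⟩)
  -- pointwise: 2 g u v ≤ T(ε u² + v²/ε) and ≥ -T(...)
  have hpt : ∀ x ∈ Icc (-1 : ℝ) 1, |2 * (g x * u x * v x)| ≤ T * (ε * u x ^ 2 + ε⁻¹ * v x ^ 2) := by
    intro x hx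
    have hy : 2 * |u x| * |v x| ≤ ε * u x ^ 2 + ε⁻¹ * v x ^ 2 := by
      have h := sq_nonneg (ε * |u x| - |v x|)
      have hε' : ε ≠ 0 := hε.ne'
      have e : ε * u x ^ 2 + ε⁻¹ * v x ^ 2 - 2 * |u x| * |v x| = (ε * |u x| - |v x|) ^ 2 / ε := by
        field_simp
        rw [← sq_abs (u x), ← sq_abs (v x)]
        ring
      have h2 : 0 ≤ (ε * |u x| - |v x|) ^ 2 / ε := div_nonneg h hε.le
      linarith
    rw [abs_mul, abs_two, abs_mul, abs_mul]
    calc 2 * (|g x| * |u x| * |v x|) = |g x| * (2 * |u x| * |v x|) := by ring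
      _ ≤ T * (ε * u x ^ 2 + ε⁻¹ * v x ^ 2) := mul_le_mul (hT x hx) hy (by positivity) hT0
  have hint : IntervalIntegrable (fun x => 2 * (g x * u x * v x)) volume (-1 : ℝ) 1 :=
    Continuous.intervalIntegrable (by fun_prop) _ _
  have hint2 : IntervalIntegrable (fun x => T * (ε * u x ^ 2 + ε⁻¹ * v x ^ 2)) volume (-1 : ℝ) 1 :=
    Continuous.intervalIntegrable (by fun_prop) _ _
  have hI : |∫ x in (-1 : ℝ)..1, 2 * (g x * u x * v x)| ≤ ∫ x in (-1 : ℝ)..1, |2 * (g x * u x * v x)| :=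
    intervalIntegral.abs_integral_le_integral_abs (by norm_num)
  have hmono : ∫ x in (-1 : ℝ)..1, |2 * (g x * u x * v x)| ≤ ∫ x in (-1 : ℝ)..1, T * (ε * u x ^ 2 + ε⁻¹ * v x ^ 2) :=
    intervalIntegral.integral_mono_on (by norm_num) hint.abs hint2 hpt
  have e1 : ∫ x in (-1 : ℝ)..1, 2 * (g x * u x * v x) = 2 * ∫ x in (-1 : ℝ)..1, g x * u x * v x := by
    rw [intervalIntegral.integral_const_mul]
  have e2 : ∫ x in (-1 : ℝ)..1, T * (ε * u x ^ 2 + ε⁻¹ * v x ^ 2)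
      = T * (ε * (∫ x in (-1 : ℝ)..1, u x ^ 2) + ε⁻¹ * (∫ x in (-1 : ℝ)..1, v x ^ 2)) := by
    rw [intervalIntegral.integral_const_mul, intervalIntegral.integral_add (Continuous.intervalIntegrable (by fun_prop) _ _)
      (Continuous.intervalIntegrable (by fun_prop) _ _), intervalIntegral.integral_const_mul, intervalIntegral.integral_const_mul]
  rw [← e1]
  exact hI.trans (hmono.trans (le_of_eq e2))

end Summit.NavierStokesRegularity.TurbBounds.LegendreTails

end
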